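import Mathlib
import Summits.KontsevichZagierPeriods.Zeta5Search.TS3RayCasLB
import Summits.KontsevichZagierPeriods.Zeta5Search.DenomLaw.RuleR1CellTS3
import Summits.KontsevichZagierPeriods.Zeta5Search.DenomLaw.RuleR
import HarnessLib

/-!
# ζ(5) search — the RULE-R1 node on TOP_STAIR #3: `RuleR1Casoratian`'s conclusion for `b := b(n)`, binders VERBATIM, every `n ≥ 1` (and every `j` on its cell)

Cell `pub-zeta5` (HONEST FRAMING: systematic search; no irrationality claim unless certified), TRACK «DENOM-LAW» D1 prover seat
(denom-prover-d1 g14, `HOME/denom-law/prover-d1/ATTEMPT-14.md` §3).  Engine-d2's typed node `DenomLaw.RuleR1Casoratian` (TYPE-LAW v2, rule R1: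
at `⌊d/p⌋ = 1` with `a = a_p(b) ≥ 1` parameters reaching `p` and the antipodal matching of the other six reaching `p`, `v_p(Cas₇(b)) ≥ (a + 1) − N_p` — one
unit above the PATH accounting) is OBSERVED/CONJECTURED for general `b`.  ON TOP_STAIR #3, `b(n) = n·(85; 35,32,30,27,25,22,20) = bRay ts3 n`, its hypotheses
single out exactly ONE θ-cell: `⌊64n/p⌋ = 1` forces `p > 32n` (first period), `a ≥ 1` forces `p ≤ 35n` and then `a = 1` (`longCount_ts3`), and the matching
`M₁(1)` = the three blocks `b₀ − b₂ − b₇ = b₀ − b₃ − b₆ = b₀ − b₄ − b₅ = 33n ≥ p` forces `p ≤ 33n`; there `N_p = 9` and the node's value is `(1 + 1) − 9 = −7`,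
which is the cell's class bound (`TS3RayCasLB.casLB_c32`, every `j`, all `n`; prover-d1 g2's `RuleR1CellTS3.ruleR1_cell` is the `j = 7` open window).  Hence
**`ruleR1Casoratian_on_ts3`: the node with `b := b(n)`, all binders verbatim, for every `n ≥ 1`** (and `ruleR1_cell_anyj`: the value `−7` on `32n < p ≤ 33n` for
every direction `j`).  MODEL/structure-side integer bookkeeping on ONE ray; the ∀-`b` node stays CONJECTURED; nothing about ζ(5); no γ; records in print UNMOVED.
-/

open Finset

namespace Summit.KontsevichZagierPeriods.Zeta5Search.StairTS3

open Summit.KontsevichZagierPeriods.Zeta5Search.ClusterValuation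
open Summit.KontsevichZagierPeriods.Zeta5Search.CasoratianValuation (InPolytope shift casoratian pairFloors refund)
open Summit.KontsevichZagierPeriods.Zeta5Search.WedgeDictionary (dOf)
open Summit.KontsevichZagierPeriods.Zeta5Search.StaircaseCells (bRay ts3)
open Summit.KontsevichZagierPeriods.Zeta5Search.DenomLaw (Sorted7 FirstPeriod BlockGe longCount MatchingR1)

/-- On `32n < p ≤ 35n` exactly one parameter reaches `p` (`b₁ = 35n`): `a_p(b(n)) = 1`. -/
theorem longCount_ts3 {n p : ℕ} (h1 : 32 * n < p) (h2 : p ≤ 35 * n) : longCount (bRay ts3 n) p = 1 := by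
  unfold longCount
  rw [card_eq_one]
  refine ⟨0, ?_⟩
  ext i
  simp only [mem_filter, mem_range, mem_singleton]
  constructor
  · rintro ⟨hi, hle⟩
    interval_cases i
    · rfl
    all_goals simp only [Nat.reduceAdd, w2, w3, w4, w5, w6, w7] at hle; omega
  · rintro rfl
    exact ⟨by norm_num, by rw [zero_add, w1]; exact_mod_cast h2⟩

/-- If some parameter reaches `p` then `p ≤ 35n`. -/
theorem le_35_of_longCount {n p : ℕ} (h : 1 ≤ longCount (bRay ts3 n) p) : p ≤ 35 * n := by
  unfold longCount at h
  obtain ⟨i, hi⟩ := card_pos.1 h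
  rw [mem_filter, mem_range] at hi
  obtain ⟨hi7, hle⟩ := hi
  interval_cases i <;> simp only [Nat.reduceAdd, w1, w2, w3, w4, w5, w6, w7] at hle <;> omega

/-- The `N_p = 9` count on `32n < p ≤ 33n` (the nine blocks `33n, 33n, 33n, 35n, 36n, 38n, 38n, 40n, 43n` reach `p`; all are `< 2p`). -/
theorem pairFloors_c32 {n p : ℕ} (hA : 32 * n < p) (hB : p ≤ 33 * n) : pairFloors (bRay ts3 n) p = 9 := by
  have hp0 : (0 : ℤ) < p := by exact_mod_cast (show 0 < p by omega)
  have hq0 : ∀ (a b : ℤ) (c : ℕ), (85 : ℤ) - a - b = c → c * n < p →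
      ((85 : ℤ) * n - a * n - b * n) / (p : ℤ) = 0 := by
    intro a b c h h2
    rw [show (85 : ℤ) * n - a * n - b * n = (c : ℤ) * n by rw [← h]; ring]
    exact Int.ediv_eq_zero_of_lt (by positivity) (by exact_mod_cast h2)
  have hq1 : ∀ (a b : ℤ) (c : ℕ), (85 : ℤ) - a - b = c → p ≤ c * n → c * n < 2 * p →
      ((85 : ℤ) * n - a * n - b * n) / (p : ℤ) = 1 := by
    intro a b c h h1 h2
    rw [show (85 : ℤ) * n - a * n - b * n = (c : ℤ) * n by rw [← h]; ring]
    have h1' : (p : ℤ) ≤ c * n := by exact_mod_cast h1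
    have h2' : ((c * n : ℕ) : ℤ) < 2 * p := by exact_mod_cast h2
    push_cast at h2'
    rw [Int.ediv_eq_iff_of_pos hp0]; constructor <;> linarith
  unfold pairFloors
  simp only [sum_range_succ, sum_range_zero, zero_add, Nat.reduceAdd, w0, w1, w2, w3, w4, w5, w6, w7, Nat.lt_irrefl, if_false,
    show (0:ℕ) < 1 by norm_num, show (0:ℕ) < 2 by norm_num, show (0:ℕ) < 3 by norm_num, show (0:ℕ) < 4 by norm_num, show (0:ℕ) < 5 by norm_num,
    show (0:ℕ) < 6 by norm_num, show (1:ℕ) < 2 by norm_num, show (1:ℕ) < 3 by norm_num, show (1:ℕ) < 4 by norm_num, show (1:ℕ) < 5 by norm_num,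
    show (1:ℕ) < 6 by norm_num, show (2:ℕ) < 3 by norm_num, show (2:ℕ) < 4 by norm_num, show (2:ℕ) < 5 by norm_num, show (2:ℕ) < 6 by norm_num,
    show (3:ℕ) < 4 by norm_num, show (3:ℕ) < 5 by norm_num, show (3:ℕ) < 6 by norm_num, show (4:ℕ) < 5 by norm_num, show (4:ℕ) < 6 by norm_num,
    show (5:ℕ) < 6 by norm_num, if_true,
    show ¬ (1:ℕ) < 0 by norm_num, show ¬ (2:ℕ) < 0 by norm_num, show ¬ (3:ℕ) < 0 by norm_num, show ¬ (4:ℕ) < 0 by norm_num, show ¬ (5:ℕ) < 0 by norm_num,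
    show ¬ (6:ℕ) < 0 by norm_num, show ¬ (2:ℕ) < 1 by norm_num, show ¬ (3:ℕ) < 1 by norm_num, show ¬ (4:ℕ) < 1 by norm_num, show ¬ (5:ℕ) < 1 by norm_num,
    show ¬ (6:ℕ) < 1 by norm_num, show ¬ (3:ℕ) < 2 by norm_num, show ¬ (4:ℕ) < 2 by norm_num, show ¬ (5:ℕ) < 2 by norm_num, show ¬ (6:ℕ) < 2 by norm_num,
    show ¬ (4:ℕ) < 3 by norm_num, show ¬ (5:ℕ) < 3 by norm_num, show ¬ (6:ℕ) < 3 by norm_num, show ¬ (5:ℕ) < 4 by norm_num, show ¬ (6:ℕ) < 4 by norm_num,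
    show ¬ (6:ℕ) < 5 by norm_num, add_zero]
  rw [hq0 35 32 18 (by norm_num) (by omega), hq0 35 30 20 (by norm_num) (by omega),
      hq0 35 27 23 (by norm_num) (by omega), hq0 35 25 25 (by norm_num) (by omega), hq0 35 22 28 (by norm_num) (by omega),
      hq0 35 20 30 (by norm_num) (by omega), hq0 32 30 23 (by norm_num) (by omega), hq0 32 27 26 (by norm_num) (by omega),
      hq0 32 25 28 (by norm_num) (by omega), hq0 32 22 31 (by norm_num) (by omega), hq1 32 20 33 (by norm_num) (by omega) (by omega),
      hq0 30 27 28 (by norm_num) (by omega), hq0 30 25 30 (by norm_num) (by omega), hq1 30 22 33 (by norm_num) (by omega) (by omega),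
      hq1 30 20 35 (by norm_num) (by omega) (by omega), hq1 27 25 33 (by norm_num) (by omega) (by omega), hq1 27 22 36 (by norm_num) (by omega) (by omega),
      hq1 27 20 38 (by norm_num) (by omega) (by omega), hq1 25 22 38 (by norm_num) (by omega) (by omega), hq1 25 20 40 (by norm_num) (by omega) (by omega),
      hq1 22 20 43 (by norm_num) (by omega) (by omega)]
  norm_num

/-- **The R1 cell `32n < p ≤ 33n` for EVERY direction `j`**: `v_p(Cas_j(b(n))) ≥ −7` (`= casLB`; `RuleR1CellTS3.ruleR1_cell` is `j = 7` on the open window). -/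
theorem ruleR1_cell_anyj {n j p : ℕ} (hn : 1 ≤ n) (hj1 : 1 ≤ j) (hj7 : j ≤ 7) (hprime : p.Prime) (hA : 32 * n < p) (hB : p ≤ 33 * n)
    (hcas : casoratian (bRay ts3 n) j ≠ 0) : (-7 : ℤ) ≤ padicValRat p (casoratian (bRay ts3 n) j) := by
  haveI : Fact p.Prime := ⟨hprime⟩
  exact (casLB_c32 (by omega) (by omega) (odd_of_prime_gt43 hprime (by omega) hn)).trans (cas_ge_casLB hn hj1 hj7 hprime (by omega) hcas)

/-- **The node `RuleR1Casoratian` restricted to TOP_STAIR #3**, literally (all its binders, `b := b(n)`), for every `n ≥ 1`: its hypotheses force the cell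
`32n < p ≤ 33n` with `a = 1`, `N_p = 9`, where the value `(1 + 1) − 9 = −7` holds. -/
theorem ruleR1Casoratian_on_ts3 (n p : ℕ) (hn : 1 ≤ n) :
    InPolytope (bRay ts3 n) → Sorted7 (bRay ts3 n) → InPolytope (shift (bRay ts3 n) 7) →
    p.Prime → 5 ≤ p → (bRay ts3 n 0 + 2 : ℤ) < (p : ℤ) ^ 2 → FirstPeriod (bRay ts3 n) p → dOf (bRay ts3 n) / (p : ℤ) = 1 →
    1 ≤ longCount (bRay ts3 n) p → MatchingR1 (bRay ts3 n) p (longCount (bRay ts3 n) p) → casoratian (bRay ts3 n) 7 ≠ 0 →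
      ((longCount (bRay ts3 n) p : ℤ) + 1) - pairFloors (bRay ts3 n) p ≤ padicValRat p (casoratian (bRay ts3 n) 7) := by
  intro _ _ _ hprime _ _ hfp hfd hlc hM hcas
  -- first period: the block `b₀ − b₆ − b₇ = 43n` is `< 2p`
  have h43 : 43 * n < 2 * p := by
    have := hfp.2 5 (by simp) 6 (by simp) (by norm_num)
    simp only [Nat.reduceAdd, w0, w6, w7] at this
    have h' : (43 * n : ℤ) < 2 * p := by linarith
    exact_mod_cast h'
  have hp0 : (0 : ℤ) < p := by exact_mod_cast hprime.pos
  -- `⌊64n/p⌋ = 1` forces `32n < p`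
  have h32 : 32 * n < p := by
    by_contra hc
    push Not at hc
    have h2 : (2 : ℤ) ≤ dOf (bRay ts3 n) / (p : ℤ) := by
      rw [dOf_ts3, Int.le_ediv_iff_mul_le hp0]
      have : (p : ℤ) ≤ 32 * n := by exact_mod_cast hc
      linarith
    omega
  -- `a ≥ 1` forces `p ≤ 35n`, hence `a = 1`, and the matching forces `p ≤ 33n`
  have h35 := le_35_of_longCount hlc
  have hL1 : longCount (bRay ts3 n) p = 1 := longCount_ts3 h32 h35
  rw [hL1] at hM ⊢
  have h33 : p ≤ 33 * n := by
    have hb : BlockGe (bRay ts3 n) p 2 7 := hM.1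
    unfold BlockGe at hb
    rw [w0, w2, w7] at hb
    have : (p : ℤ) ≤ 33 * n := by linarith
    exact_mod_cast this
  rw [pairFloors_c32 h32 h33]
  push_cast
  linarith [ruleR1_cell_anyj (j := 7) hn (by norm_num) (by norm_num) hprime h32 h33 hcas]

end Summit.KontsevichZagierPeriods.Zeta5Search.StairTS3
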